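import Summits.CriticalPhenomena.CardyFormulaZ2.Theorems.CardyBoundaryCoulombGasRectilinearCardyClosureDefs
import Summits.CriticalPhenomena.CardyFormulaZ2.Theorems.CardyBoundaryCoulombGasRectilinearCardyStubKernelWindowLawPart5
import Summits.CriticalPhenomena.CardyFormulaZ2.Theorems.RectilinearCardy.Negative.RectilinearCardyReductions
import HarnessLib

/-!
# Stub C of line `excursion-kernel-covariance` (crux `RectilinearCardy`, stmt-CriticalPhenomena-5660,
# route `CardyBoundaryCoulombGas`): the PARTITION IDENTITY on flat windows

`stub_densityPartition`: for an admissible (flat) parameter range `[σ, σ']` of a conformal rectangle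
`R` and a window `σ ≤ s ≤ s' ≤ σ'`, for all small meshes `δ`,
`Q^cl_δ(s) - Q^cl_δ(s') = densityMass R δ s - densityMass R δ s'`.

Proof outline ("the last joined vertex").
* Abstract percolation part (`dp_sdiff_subset_biUnion`, `dp_biUnion_subset_sdiff`,
  `dp_pairwiseDisjoint`, `dp_measureReal_sub`): for target Finsets `T' ⊆ T`, `W = T ∖ T'`, sets
  `B v` ("beyond `v`") and a real label `f` on `W` such that `T' ⊆ B v`, `f v < f w → w ∈ B v`,
  `B v ⊆ T' ∪ {w ∈ W | f v < f w}` and `f` is injective on `W`, the difference of the crossing events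
  `{A ↔ T} ∖ {A ↔ T'}` is the DISJOINT union over `v ∈ W` of `{A ↔ v} ∖ {A ↔ B v}` (given `ω` in
  the difference, take the joined vertex of `W` with the largest label — `Finset.exists_max_image`),
  whence `μ(A ↔ T) - μ(A ↔ T') = Σ_{v ∈ W} μ({A ↔ v} ∖ {A ↔ B v})` (`measureReal_sdiff`,
  `measureReal_biUnion_finset`; measurability from the tree's `measurableSet_openCrossing`).
* Geometry (`dp_mem_rowTail_iff`, `dp_window_structure`): enlarge the range
  (`kwl_exists_admissible_enlarge`), take its window frame (`kwl_exists_windowFrame`) and separation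
  radius (`kwl_exists_param_sep`); for `0 < δ`, `4δ ≤ r`, `2δ < d₀` every `v ∈ W_δ =
  rowTail s ∖ rowTail s'` is a row vertex with a foot `∂Ω(u_v)`, `u_v ∈ [s, s')` (`kwl_sdiff_vertex`),
  and the closest-arc rule `v ∈ rowTail t ↔ t ≤ u_v` holds for ALL `t ∈ [mark 1, mark 3]`
  (`kwl_mem_rowTail_iff` inside the range, `rowTail_mono` outside). Consequently `rowBeyond v` is
  squeezed as required with the label `f = u`, injective by `kwl_eq_of_tng_eq_of_nrm_eq`.
* Assembly: `densityMass_sub_eq_sum_sdiff` and the abstract part, eventually in `δ` via `Ioo_mem_nhdsGT`.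
-/

noncomputable section

open Set Filter Topology MeasureTheory
open Literature.Probability.RandomPlanarGeometry
open Literature.Probability.Percolation (half bondPercolation openCrossing openConnIn BondConfig
  measurableSet_openCrossing)
open Literature.Probability.LatticeModels (Site meshPoint zdGraph Orient)
open Summit.CriticalPhenomena.CardyFormulaZ2.Theorems.RectilinearCardy.Negative (IsRectilinear)

namespace Summit.CriticalPhenomena.CardyFormulaZ2.Cruxes.RectilinearCardy.ExcursionKernelCovariance

/-! ### The last-joined-vertex decomposition (abstract percolation bookkeeping) -/

/-- A crossing to a vertex of the target is a crossing to the target. [folklore] -/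
theorem dp_singleton_subset {V : Type*} (S A : Set V) {v : V} {B : Set V} (hv : v ∈ B) :
    openCrossing S A {v} ⊆ openCrossing S A B :=
  openCrossing_mono_target S A (Set.singleton_subset_iff.2 hv)

/-- **The difference of two crossing events is covered by the last-joined-vertex events.** If every
vertex beyond `v` is in the smaller target or is a window vertex with a larger label, then a
configuration joining `A` to `T` but not to `T'` joins `A` to a window vertex `v` (the joined one with
the largest label) and to no vertex beyond `v`. [folklore] -/
theorem dp_sdiff_subset_biUnion {V : Type*} [DecidableEq V] (S A : Set V) (T T' : Finset V)
    (B : V → Finset V) (f : V → ℝ)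
    (h3 : ∀ v ∈ T \ T', ∀ w ∈ B v, w ∈ T' ∨ (w ∈ T \ T' ∧ f v < f w)) :
    openCrossing S A ↑T \ openCrossing S A ↑T' ⊆
      ⋃ v ∈ T \ T', (openCrossing S A {v} \ openCrossing S A ↑(B v)) := by
  classical
  rintro ω ⟨⟨x, hx, y, hy, hω⟩, hω'⟩
  set J : Finset V := (T \ T').filter fun w => ω ∈ openCrossing S A {w} with hJ
  have hyJ : y ∈ J :=
    Finset.mem_filter.2 ⟨Finset.mem_sdiff.2 ⟨hy, fun hy' => hω' ⟨x, hx, y, hy', hω⟩⟩,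
      x, hx, y, rfl, hω⟩
  obtain ⟨v, hvJ, hmax⟩ := J.exists_max_image f ⟨y, hyJ⟩
  obtain ⟨hvW, hωv⟩ := Finset.mem_filter.1 hvJ
  refine Set.mem_iUnion₂.2 ⟨v, hvW, hωv, ?_⟩
  rintro ⟨x', hx', w, hw, hω''⟩
  rcases h3 v hvW w hw with hwT' | ⟨hwW, hlt⟩
  · exact hω' ⟨x', hx', w, hwT', hω''⟩
  · exact (not_lt.2 (hmax w (Finset.mem_filter.2 ⟨hwW, x', hx', w, rfl, hω''⟩))) hlt

/-- **The last-joined-vertex events lie in the difference** (the smaller target is beyond every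
window vertex). [folklore] -/
theorem dp_biUnion_subset_sdiff {V : Type*} [DecidableEq V] (S A : Set V) (T T' : Finset V)
    (B : V → Finset V) (h1 : ∀ v ∈ T \ T', T' ⊆ B v) :
    (⋃ v ∈ T \ T', (openCrossing S A {v} \ openCrossing S A ↑(B v))) ⊆
      openCrossing S A ↑T \ openCrossing S A ↑T' := by
  intro ω hω
  obtain ⟨v, hvW, hωv, hωB⟩ := Set.mem_iUnion₂.1 hω
  exact ⟨dp_singleton_subset S A (Finset.mem_coe.2 (Finset.mem_sdiff.1 hvW).1) hωv,
    fun h => hωB (openCrossing_mono_target S A (Finset.coe_subset.2 (h1 v hvW)) h)⟩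

/-- **The last-joined-vertex events are pairwise disjoint** (of two window vertices, the one with
the larger label is beyond the other). [folklore] -/
theorem dp_pairwiseDisjoint {V : Type*} (S A : Set V) (W : Finset V) (B : V → Finset V)
    (f : V → ℝ) (h2 : ∀ v ∈ W, ∀ w ∈ W, f v < f w → w ∈ B v)
    (hinj : ∀ v ∈ W, ∀ w ∈ W, f v = f w → v = w) :
    (↑W : Set V).PairwiseDisjoint fun v => openCrossing S A {v} \ openCrossing S A ↑(B v) := by
  have key : ∀ v ∈ W, ∀ w ∈ W, f v < f w →
      Disjoint (openCrossing S A {v} \ openCrossing S A ↑(B v))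
        (openCrossing S A {w} \ openCrossing S A ↑(B w)) := by
    intro v hv w hw hlt
    exact Set.disjoint_left.2 fun ω hωv hωw =>
      hωv.2 (dp_singleton_subset S A (Finset.mem_coe.2 (h2 v hv w hw hlt)) hωw.1)
  intro v hv w hw hne
  rcases lt_or_gt_of_ne (fun h => hne (hinj v hv w hw h)) with hlt | hlt
  · exact key v hv w hw hlt
  · exact (key w hw v hv hlt).symm

/-- **The partition identity, abstract form**: under the three squeezing hypotheses on the sets
`B v` and injectivity of the label, `μ(A ↔ T) - μ(A ↔ T') = Σ_{v ∈ T ∖ T'} μ({A ↔ v} ∖ {A ↔ B v})`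
for a finite measure and a finite region `S`. [folklore] -/
theorem dp_measureReal_sub {V : Type*} [DecidableEq V] (μ : Measure (BondConfig V))
    [IsFiniteMeasure μ] (S : Finset V) (A : Set V) (T T' : Finset V) (B : V → Finset V)
    (f : V → ℝ) (hT : T' ⊆ T) (h1 : ∀ v ∈ T \ T', T' ⊆ B v)
    (h2 : ∀ v ∈ T \ T', ∀ w ∈ T \ T', f v < f w → w ∈ B v)
    (h3 : ∀ v ∈ T \ T', ∀ w ∈ B v, w ∈ T' ∨ (w ∈ T \ T' ∧ f v < f w))
    (hinj : ∀ v ∈ T \ T', ∀ w ∈ T \ T', f v = f w → v = w) :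
    μ.real (openCrossing ↑S A ↑T) - μ.real (openCrossing ↑S A ↑T') =
      ∑ v ∈ T \ T', μ.real (openCrossing ↑S A {v} \ openCrossing ↑S A ↑(B v)) := by
  have hsub : openCrossing (↑S : Set V) A ↑T' ⊆ openCrossing ↑S A ↑T :=
    openCrossing_mono_target _ _ (Finset.coe_subset.2 hT)
  have hmeas : MeasurableSet (openCrossing (↑S : Set V) A ↑T') := measurableSet_openCrossing S A _
  have hset : openCrossing (↑S : Set V) A ↑T \ openCrossing ↑S A ↑T' =
      ⋃ v ∈ T \ T', (openCrossing (↑S : Set V) A {v} \ openCrossing ↑S A ↑(B v)) :=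
    Set.Subset.antisymm (dp_sdiff_subset_biUnion _ A T T' B f h3)
      (dp_biUnion_subset_sdiff _ A T T' B h1)
  have hdisj := dp_pairwiseDisjoint (↑S : Set V) A (T \ T') B f h2 hinj
  have hmeas' : ∀ v ∈ T \ T',
      MeasurableSet (openCrossing (↑S : Set V) A {v} \ openCrossing ↑S A ↑(B v)) :=
    fun v _ => (measurableSet_openCrossing S A _).diff (measurableSet_openCrossing S A _)
  rw [← measureReal_sdiff hsub hmeas (measure_ne_top μ _), hset]
  exact measureReal_biUnion_finset hdisj hmeas' fun v _ => measure_ne_top μ _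

/-! ### Geometry of the window vertices -/

/-- **The closest-arc rule on the whole parameter range.** For a row vertex `v` of a window frame on
`[σ, σ']` with foot `∂Ω(u)`, `σ ≤ u < σ'`, and ANY `t ∈ [mark 1, mark 3]`:
`v ∈ rowTail R δ t ↔ t ≤ u` (`kwl_mem_rowTail_iff` for `t` inside the range; outside, `rowTail` is
antitone in `t`). [folklore] -/
theorem dp_mem_rowTail_iff (R : ConformalRectangle) {o : Orient} {h r σ σ' : ℝ}
    (h1 : R.mark 1 < σ) (h3 : σ' < R.mark 3)
    (hcl : ∀ t ∈ Icc σ σ', ∀ z, dist z (R.boundary t) < r →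
      (z ∈ closure R.carrier ↔ h ≤ Orient.nrmC o z))
    (hop : ∀ t ∈ Icc σ σ', ∀ z, dist z (R.boundary t) < r → (z ∈ R.carrier ↔ h < Orient.nrmC o z))
    {δ : ℝ} (hδ : 0 < δ) (hδr : 2 * δ ≤ r) {v : Site 2} (hv : v ∈ boundaryRow R δ)
    (hvn : Orient.nrm o v = ⌈h / δ⌉) {u : ℝ} (hu : u ∈ Icc σ σ') (huσ' : u < σ')
    (hfoot : R.boundary u =
      (((δ * (Orient.tng o v : ℝ) : ℝ)) : ℂ) * Orient.e o + ((h : ℝ) : ℂ) * Orient.ν o)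
    {t : ℝ} (ht : t ∈ Icc (R.mark 1) (R.mark 3)) : v ∈ rowTail R δ t ↔ t ≤ u := by
  have key := fun (s : ℝ) (hs : s ∈ Icc σ σ') =>
    kwl_mem_rowTail_iff R h1 h3 hcl hop hδ hδr hv hvn hu hfoot hs
  have hσσ' : σ ≤ σ' := hu.1.trans hu.2
  rcases lt_or_ge t σ with htσ | htσ
  · exact ⟨fun _ => htσ.le.trans hu.1, fun _ =>
      rowTail_mono R δ ht.1 htσ.le (hσσ'.trans h3.le) ((key σ ⟨le_rfl, hσσ'⟩).2 hu.1)⟩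
  rcases le_or_gt t σ' with htσ' | htσ'
  · exact key t ⟨htσ, htσ'⟩
  · refine ⟨fun hvt => ?_, fun htu => absurd (huσ'.trans htσ') (not_lt.2 htu)⟩
    have := (key σ' ⟨hσσ', le_rfl⟩).1 (rowTail_mono R δ (h1.le.trans hσσ') htσ'.le ht.2 hvt)
    exact absurd huσ' (not_lt.2 this)

/-- **Structure of the window vertices.** In a window frame on `[σ, σ']` with `σ < s ≤ s' < σ'`, for
`0 < δ`, `4δ ≤ r`, `2δ < d₀`: there is a label `f` (the foot parameter) on
`W = rowTail s ∖ rowTail s'` such that `rowTail s' ⊆ rowBeyond v`, `f v < f w → w ∈ rowBeyond v`,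
`rowBeyond v ⊆ rowTail s' ∪ {w ∈ W | f v < f w}` for `v, w ∈ W`, and `f` is injective on `W`.
[folklore] -/
theorem dp_window_structure (R : ConformalRectangle) {o : Orient} {h r σ σ' s s' : ℝ}
    (h1 : R.mark 1 < σ) (hσs : σ < s) (hss' : s ≤ s') (hs'σ' : s' < σ') (h3 : σ' < R.mark 3)
    (hcl : ∀ t ∈ Icc σ σ', ∀ z, dist z (R.boundary t) < r →
      (z ∈ closure R.carrier ↔ h ≤ Orient.nrmC o z))
    (hop : ∀ t ∈ Icc σ σ', ∀ z, dist z (R.boundary t) < r → (z ∈ R.carrier ↔ h < Orient.nrmC o z))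
    {d₀ : ℝ} (hd₀ : ∀ z ∈ frontier R.carrier, ∀ τ ∈ Icc s s', dist z (R.boundary τ) < d₀ →
      ∃ u ∈ Ioo σ σ', R.boundary u = z)
    {δ : ℝ} (hδ : 0 < δ) (hδr : 4 * δ ≤ r) (hδd : 2 * δ < d₀) :
    ∃ f : Site 2 → ℝ,
      (∀ v ∈ rowTail R δ s \ rowTail R δ s', rowTail R δ s' ⊆ rowBeyond R δ v) ∧
      (∀ v ∈ rowTail R δ s \ rowTail R δ s', ∀ w ∈ rowTail R δ s \ rowTail R δ s',
        f v < f w → w ∈ rowBeyond R δ v) ∧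
      (∀ v ∈ rowTail R δ s \ rowTail R δ s', ∀ w ∈ rowBeyond R δ v,
        w ∈ rowTail R δ s' ∨ (w ∈ rowTail R δ s \ rowTail R δ s' ∧ f v < f w)) ∧
      (∀ v ∈ rowTail R δ s \ rowTail R δ s', ∀ w ∈ rowTail R δ s \ rowTail R δ s',
        f v = f w → v = w) := by
  set W : Finset (Site 2) := rowTail R δ s \ rowTail R δ s' with hW
  have hWv : ∀ v ∈ W, Orient.nrm o v = ⌈h / δ⌉ ∧ ∃ u ∈ Ico s s',
      R.boundary u = (((δ * (Orient.tng o v : ℝ) : ℝ)) : ℂ) * Orient.e o + ((h : ℝ) : ℂ) * Orient.ν o ∧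
      dist (meshPoint δ v) (R.boundary u) < δ :=
    fun v hv => kwl_sdiff_vertex R h1 hσs hss' hs'σ' h3 hcl hop hd₀ hδ hδr hδd hv
  have hWv' : ∀ v, v ∈ W → ∃ u : ℝ, u ∈ Ico s s' ∧
      R.boundary u = (((δ * (Orient.tng o v : ℝ) : ℝ)) : ℂ) * Orient.e o + ((h : ℝ) : ℂ) * Orient.ν o :=
    fun v hv => by
      obtain ⟨-, u, hu, hux, -⟩ := hWv v hv
      exact ⟨u, hu, hux⟩
  choose! f hf using hWv'
  have hnrm : ∀ v ∈ W, Orient.nrm o v = ⌈h / δ⌉ := fun v hv => (hWv v hv).1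
  have hrow : ∀ v ∈ W, v ∈ boundaryRow R δ := fun v hv =>
    rowTail_subset R δ s (Finset.mem_sdiff.1 hv).1
  have hm1s : R.mark 1 ≤ s := h1.le.trans hσs.le
  have hs'm3 : s' ≤ R.mark 3 := hs'σ'.le.trans h3.le
  have hfI : ∀ v ∈ W, f v ∈ Icc σ σ' := fun v hv =>
    ⟨hσs.le.trans (hf v hv).1.1, (hf v hv).1.2.le.trans hs'σ'.le⟩
  have hfI' : ∀ v ∈ W, f v ∈ Icc (R.mark 1) (R.mark 3) := fun v hv =>
    ⟨hm1s.trans (hf v hv).1.1, (hf v hv).1.2.le.trans hs'm3⟩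
  -- the closest-arc rule on the whole range
  have key : ∀ v ∈ W, ∀ t ∈ Icc (R.mark 1) (R.mark 3), v ∈ rowTail R δ t ↔ t ≤ f v :=
    fun v hv t ht => dp_mem_rowTail_iff R h1 h3 hcl hop hδ (by linarith) (hrow v hv) (hnrm v hv)
      (hfI v hv) ((hf v hv).1.2.trans hs'σ') (hf v hv).2 ht
  -- the label is injective
  have hinj : ∀ v ∈ W, ∀ w ∈ W, f v = f w → v = w := by
    intro v hv w hw heq
    have h' := (hf v hv).2
    rw [heq, (hf w hw).2] at h'
    have ht := congrArg (Orient.tngC o) h'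
    rw [Orient.tngC_combo, Orient.tngC_combo] at ht
    have : (Orient.tng o w : ℝ) = Orient.tng o v := mul_left_cancel₀ hδ.ne' ht
    exact kwl_eq_of_tng_eq_of_nrm_eq (by exact_mod_cast this.symm) (by rw [hnrm v hv, hnrm w hw])
  -- membership in `rowBeyond v` through the closest-arc rule
  have hbey : ∀ v ∈ W, ∀ w ∈ boundaryRow R δ, w ≠ v →
      (∀ t ∈ Icc (R.mark 1) (R.mark 3), t ≤ f v → w ∈ rowTail R δ t) → w ∈ rowBeyond R δ v := by
    intro v hv w hw hne H
    exact (mem_rowBeyond_iff R).2 ⟨hw, hne, fun t ht hvt => H t ht ((key v hv t ht).1 hvt)⟩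
  refine ⟨f, ?_, ?_, ?_, hinj⟩
  · intro v hv w hw
    have hvs' : v ∉ rowTail R δ s' := (Finset.mem_sdiff.1 hv).2
    refine hbey v hv w (rowTail_subset R δ s' hw) (fun h => hvs' (by rw [← h]; exact hw))
      fun t ht htv => ?_
    exact rowTail_mono R δ ht.1 (htv.trans (hf v hv).1.2.le) hs'm3 hw
  · intro v hv w hw hlt
    refine hbey v hv w (hrow w hw) (fun h => ?_) fun t ht htv => (key w hw t ht).2 (htv.trans hlt.le)
    rw [h] at hlt
    exact lt_irrefl _ hlt
  · intro v hv w hw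
    obtain ⟨-, hne, H⟩ := (mem_rowBeyond_iff R).1 hw
    have hwfv : w ∈ rowTail R δ (f v) :=
      H (f v) (hfI' v hv) ((key v hv (f v) (hfI' v hv)).2 le_rfl)
    have hws : w ∈ rowTail R δ s := rowTail_mono R δ hm1s (hf v hv).1.1 (hfI' v hv).2 hwfv
    by_cases hws' : w ∈ rowTail R δ s'
    · exact Or.inl hws'
    · have hwW : w ∈ W := Finset.mem_sdiff.2 ⟨hws, hws'⟩
      exact Or.inr ⟨hwW, lt_of_le_of_ne ((key w hwW (f v) (hfI' v hv)).1 hwfv)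
        fun heq => hne (hinj v hv w hwW heq).symm⟩

/-! ### The stub -/

/-- **Stub C of line excursion-kernel-covariance (crux RectilinearCardy, stmt-CriticalPhenomena-5660)** (registered signature, verbatim). [folklore] -/
theorem stub_densityPartition :
    ∀ R : ConformalRectangle, IsRectilinear R →
      ∀ σ σ' : ℝ, AdmissibleRange R σ σ' → ∀ s s' : ℝ, σ ≤ s → s ≤ s' → s' ≤ σ' →
        ∀ᶠ δ in 𝓝[>] (0 : ℝ),
          closureTailProb R δ s - closureTailProb R δ s' = densityMass R δ s - densityMass R δ s' := by
  intro R _ σ σ' hadm s s' hσs hss' hs'σ'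
  obtain ⟨σ₁, σ₁', hadm₁, hσ₁s, hs'σ₁'⟩ := kwl_exists_admissible_enlarge R hadm hσs hss' hs'σ'
  obtain ⟨o, h, r, hr, hframe⟩ := kwl_exists_windowFrame R hadm₁
  obtain ⟨h1, -, h3, -⟩ := hadm₁
  have hcl : ∀ t ∈ Icc σ₁ σ₁', ∀ z, dist z (R.boundary t) < r →
      (z ∈ closure R.carrier ↔ h ≤ Orient.nrmC o z) := fun t ht => (hframe t ht).2.1
  have hop : ∀ t ∈ Icc σ₁ σ₁', ∀ z, dist z (R.boundary t) < r →
      (z ∈ R.carrier ↔ h < Orient.nrmC o z) := fun t ht => (hframe t ht).2.2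
  obtain ⟨d₀, hd₀, hsep⟩ := kwl_exists_param_sep R h1 hσ₁s hss' hs'σ₁' h3
  have hsmall : ∀ᶠ δ in 𝓝[>] (0 : ℝ), 0 < δ ∧ δ < min (r / 4) (d₀ / 2) :=
    Ioo_mem_nhdsGT (by positivity)
  filter_upwards [hsmall] with δ hδI
  obtain ⟨hδ, hδlt⟩ := hδI
  have hδr : 4 * δ ≤ r := by have := lt_of_lt_of_le hδlt (min_le_left _ _); linarith
  have hδd : 2 * δ < d₀ := by have := lt_of_lt_of_le hδlt (min_le_right _ _); linarith
  have hm1s : R.mark 1 ≤ s := h1.le.trans hσ₁s.le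
  have hs'm3 : s' ≤ R.mark 3 := hs'σ₁'.le.trans h3.le
  obtain ⟨f, hB1, hB2, hB3, hinj⟩ :=
    dp_window_structure R h1 hσ₁s hss' hs'σ₁' h3 hcl hop hsep hδ hδr hδd
  rw [densityMass_sub_eq_sum_sdiff R δ hm1s hss' hs'm3]
  unfold closureTailProb closureDensity
  exact dp_measureReal_sub (bondPercolation (zdGraph 2) half) (closureFinset R δ) ↑(rowArc R δ)
    (rowTail R δ s) (rowTail R δ s') (rowBeyond R δ) f (rowTail_mono R δ hm1s hss' hs'm3)
    hB1 hB2 hB3 hinj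

end Summit.CriticalPhenomena.CardyFormulaZ2.Cruxes.RectilinearCardy.ExcursionKernelCovariance

end
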